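import Mathlib.RingTheory.Nilpotent.Exp
import Mathlib.Analysis.Normed.Field.Basic
import Mathlib.Algebra.Order.BigOperators.Ring.Finset
import HarnessLib

/-!
# The algebra of polymer activities: circle product, nilpotent exponential, weighted `ℓ¹` norms

The bookkeeping device of polymer / cluster expansions and of Brydges–Yau–Dimock–Slade
renormalisation-group steps. Fix a finite set `Λ` of blocks; a **polymer** is a subset `X ⊆ Λ` and a
**polymer activity** is a function `K : 𝒫(Λ) → R` into a commutative ring (in applications an
algebra of smooth functionals of the field). The **circle product**

  `(K ∘ L)(X) = ∑_{Y ⊆ X} K(Y) L(X ∖ Y)`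

makes the activities a commutative ring `PolymerActivity Λ R` with unit `𝟙_∅` (Brydges 2009, §3.1;
it is the square-free truncation `R[x_b : b ∈ Λ]/(x_b²)` of the polynomial ring, `K ↔ ∑_X K(X)x^X`):
e.g. the partition function of a polymer gas with interaction `e^{-V}` on the complement is
`Z(Λ) = (e^{-V} ∘ K)(Λ)`, and the standard representation of an RG step is `Z_j = (I_j ∘ K_j)(Λ)`.

* `PolymerActivity.mul_apply`, `CommRing` instance — `∘` is commutative, associative, bilinear with
  unit `𝟙_∅` (`one_apply`);
* `pow_apply_eq_zero_of_card_lt`, `isNilpotent_of_apply_empty` — an activity vanishing on `∅` is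
  nilpotent (`K^{∘n}(X) = 0` for `|X| < n`), so its **polymer exponential**
  `ℰxp K = ∑_n K^{∘n}/n!` is Mathlib's `IsNilpotent.exp` and `ℰxp(K + L) = ℰxp K ∘ ℰxp L`
  (`exp_add_of_apply_empty`) — the identity behind "the exponential of the connected parts is the
  sum over all polymer configurations";
* `norm_mul_le` — for a normed ring `R` and a weight `w` with `w(Y ∪ Z) ≤ w(Y)w(Z)` on disjoint
  pairs (e.g. `w(X) = Γ^{|X|}`), the weighted `ℓ¹` norm `‖K‖_w = ∑_X w(X)‖K(X)‖` is
  submultiplicative: `‖K ∘ L‖_w ≤ ‖K‖_w ‖L‖_w` (Brydges 2009, Prop. 3.2-type estimate).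

## References

* D. C. Brydges, *Lectures on the renormalisation group*, in: Statistical Mechanics (IAS/Park City
  Math. Ser. 16), AMS 2009, §3 (polymer activities, circle product, `ℰxp`). [Brydges2009LecturesRG]
* J. Dimock, *The renormalization group according to Balaban I. Small fields*, Rev. Math. Phys. 25
  (2013) 1330010, §2.3 (polymer activities and norms). [Dimock2013]
-/

noncomputable section

namespace Literature.MathematicalPhysics.QuantumFieldTheory

open Finset

/-- **Polymer activities** on the finite set of blocks `Λ` with values in `R`: functions on the
subsets ("polymers") of `Λ`. A type synonym of `Finset Λ → R` carrying the circle product as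
multiplication. [cite: Brydges2009LecturesRG, §3.1] -/
def PolymerActivity (Λ : Type*) (R : Type*) := Finset Λ → R

namespace PolymerActivity

variable {Λ : Type*} {R : Type*}

/-- Pointwise addition of activities. [folklore] -/
instance [AddCommGroup R] : AddCommGroup (PolymerActivity Λ R) := inferInstanceAs (AddCommGroup (Finset Λ → R))

/-- The default activity. [folklore] -/
instance [Inhabited R] : Inhabited (PolymerActivity Λ R) := inferInstanceAs (Inhabited (Finset Λ → R))

/-- Pointwise scalar action on activities. [folklore] -/
instance {S : Type*} [Semiring S] [AddCommGroup R] [Module S R] : Module S (PolymerActivity Λ R) :=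
  inferInstanceAs (Module S (Finset Λ → R))

/-- View a function on polymers as a polymer activity. [folklore] -/
def of (K : Finset Λ → R) : PolymerActivity Λ R := K

/-- Evaluation at a polymer, as an additive monoid homomorphism. [folklore] -/
def evalAddMonoidHom [AddCommGroup R] (X : Finset Λ) : PolymerActivity Λ R →+ R where
  toFun K := K X
  map_zero' := rfl
  map_add' _ _ := rfl

/-- Finite sums of activities are evaluated termwise. [folklore] -/
theorem finset_sum_apply [AddCommGroup R] {ι : Type*} (s : Finset ι) (f : ι → PolymerActivity Λ R) (X : Finset Λ) :
    (∑ i ∈ s, f i) X = ∑ i ∈ s, f i X :=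
  map_sum (evalAddMonoidHom X) f s

/-- Evaluation of `of`. [folklore] -/
@[simp] theorem of_apply (K : Finset Λ → R) (X : Finset Λ) : of K X = K X := rfl

/-- Extensionality. [folklore] -/
@[ext] theorem ext {K L : PolymerActivity Λ R} (h : ∀ X, K X = L X) : K = L := funext h

/-- Pointwise addition. [folklore] -/
@[simp] theorem add_apply [AddCommGroup R] (K L : PolymerActivity Λ R) (X : Finset Λ) : (K + L) X = K X + L X := rfl

/-- The zero activity. [folklore] -/
@[simp] theorem zero_apply [AddCommGroup R] (X : Finset Λ) : (0 : PolymerActivity Λ R) X = 0 := rfl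

/-- Pointwise negation. [folklore] -/
@[simp] theorem neg_apply [AddCommGroup R] (K : PolymerActivity Λ R) (X : Finset Λ) : (-K) X = -K X := rfl

/-- Pointwise subtraction. [folklore] -/
@[simp] theorem sub_apply [AddCommGroup R] (K L : PolymerActivity Λ R) (X : Finset Λ) : (K - L) X = K X - L X := rfl

/-- Pointwise scalar multiplication. [folklore] -/
@[simp] theorem smul_apply {S : Type*} [Semiring S] [AddCommGroup R] [Module S R] (c : S)
    (K : PolymerActivity Λ R) (X : Finset Λ) : (c • K) X = c • K X := rfl

variable [DecidableEq Λ] [CommRing R]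

/-! ### The circle product -/

/-- **The circle product** `(K ∘ L)(X) = ∑_{Y ⊆ X} K(Y) L(X ∖ Y)`, as the multiplication of
`PolymerActivity Λ R`. [cite: Brydges2009LecturesRG, §3.1] -/
instance : Mul (PolymerActivity Λ R) := ⟨fun K L X => ∑ Y ∈ X.powerset, K Y * L (X \ Y)⟩

/-- **The unit** `𝟙_∅`: `1` on the empty polymer, `0` elsewhere. [cite: Brydges2009LecturesRG, §3.1] -/
instance : One (PolymerActivity Λ R) := ⟨fun X => if X = ∅ then 1 else 0⟩

/-- Unfolding the circle product. [cite: Brydges2009LecturesRG, §3.1] -/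
theorem mul_apply (K L : PolymerActivity Λ R) (X : Finset Λ) :
    (K * L) X = ∑ Y ∈ X.powerset, K Y * L (X \ Y) := rfl

/-- Unfolding the unit. [folklore] -/
theorem one_apply (X : Finset Λ) : (1 : PolymerActivity Λ R) X = if X = ∅ then 1 else 0 := rfl

/-- `𝟙_∅(∅) = 1`. [folklore] -/
@[simp] theorem one_apply_empty : (1 : PolymerActivity Λ R) ∅ = 1 := by simp [one_apply]

/-- `𝟙_∅(X) = 0` for non-empty `X`. [folklore] -/
theorem one_apply_of_ne_empty {X : Finset Λ} (hX : X ≠ ∅) : (1 : PolymerActivity Λ R) X = 0 := by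
  simp [one_apply, hX]

/-- The circle product on the empty polymer is the product of the values at `∅`. [folklore] -/
@[simp] theorem mul_apply_empty (K L : PolymerActivity Λ R) : (K * L) ∅ = K ∅ * L ∅ := by
  simp [mul_apply]

/-- **Commutativity** of the circle product (re-index `Y ↦ X ∖ Y`). [cite: Brydges2009LecturesRG, §3.1] -/
protected theorem mul_comm (K L : PolymerActivity Λ R) : K * L = L * K := by
  ext X
  rw [mul_apply, mul_apply]
  refine sum_nbij' (fun Y => X \ Y) (fun Y => X \ Y) (fun Y _ => mem_powerset.2 sdiff_subset)
    (fun Y _ => mem_powerset.2 sdiff_subset) (fun Y hY => Finset.sdiff_sdiff_eq_self (mem_powerset.1 hY))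
    (fun Y hY => Finset.sdiff_sdiff_eq_self (mem_powerset.1 hY)) fun Y hY => ?_
  rw [Finset.sdiff_sdiff_eq_self (mem_powerset.1 hY), mul_comm]

/-- **Associativity** of the circle product: both sides equal `∑_{Z ⊔ W ⊔ V = X} K(Z)L(W)N(V)`
(bijection `(Y ⊇ Z) ↦ (Z, Y ∖ Z)`). [cite: Brydges2009LecturesRG, §3.1] -/
protected theorem mul_assoc (K L N : PolymerActivity Λ R) : K * L * N = K * (L * N) := by
  ext X
  simp only [mul_apply, sum_mul, mul_sum]
  rw [sum_sigma', sum_sigma']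
  refine sum_nbij' (fun p => ⟨p.2, p.1 \ p.2⟩) (fun q => ⟨q.1 ∪ q.2, q.1⟩) ?_ ?_ ?_ ?_ ?_
  · rintro ⟨Y, Z⟩ h
    simp only [mem_sigma, mem_powerset] at h ⊢
    exact ⟨h.2.trans h.1, sdiff_subset_sdiff h.1 le_rfl⟩
  · rintro ⟨Z, W⟩ h
    simp only [mem_sigma, mem_powerset] at h ⊢
    exact ⟨union_subset h.1 (h.2.trans sdiff_subset), subset_union_left⟩
  · rintro ⟨Y, Z⟩ h
    simp only [mem_sigma, mem_powerset] at h
    simp only [union_sdiff_of_subset h.2]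
  · rintro ⟨Z, W⟩ h
    simp only [mem_sigma, mem_powerset] at h
    have hd : Disjoint Z W := disjoint_of_subset_right h.2 disjoint_sdiff
    simp only [union_sdiff_cancel_left hd]
  · rintro ⟨Y, Z⟩ h
    simp only [mem_sigma, mem_powerset] at h
    simp only
    rw [sdiff_sdiff_left, Finset.sup_eq_union, union_sdiff_of_subset h.2, mul_assoc]

/-- `𝟙_∅` is a left unit. [folklore] -/
protected theorem one_mul (K : PolymerActivity Λ R) : 1 * K = K := by
  ext X
  rw [mul_apply, sum_eq_single_of_mem ∅ (empty_mem_powerset X)]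
  · simp
  · intro Y _ hY
    rw [one_apply_of_ne_empty hY, zero_mul]

/-- `𝟙_∅` is a right unit. [folklore] -/
protected theorem mul_one (K : PolymerActivity Λ R) : K * 1 = K := by
  rw [PolymerActivity.mul_comm, PolymerActivity.one_mul]

/-- Left distributivity. [folklore] -/
protected theorem mul_add (K L N : PolymerActivity Λ R) : K * (L + N) = K * L + K * N := by
  ext X
  simp only [mul_apply, add_apply, mul_add, sum_add_distrib]

/-- Right distributivity. [folklore] -/
protected theorem add_mul (K L N : PolymerActivity Λ R) : (K + L) * N = K * N + L * N := by
  ext X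
  simp only [mul_apply, add_apply, add_mul, sum_add_distrib]

/-- `0 ∘ K = 0`. [folklore] -/
protected theorem zero_mul (K : PolymerActivity Λ R) : 0 * K = 0 := by
  ext X; simp [mul_apply]

/-- `K ∘ 0 = 0`. [folklore] -/
protected theorem mul_zero (K : PolymerActivity Λ R) : K * 0 = 0 := by
  ext X; simp [mul_apply]

/-- **Polymer activities form a commutative ring** under pointwise addition and the circle product.
[cite: Brydges2009LecturesRG, §3.1] -/
instance instCommRing : CommRing (PolymerActivity Λ R) :=
  { (inferInstance : AddCommGroup (PolymerActivity Λ R)) with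
    mul := (· * ·)
    one := 1
    mul_assoc := PolymerActivity.mul_assoc
    one_mul := PolymerActivity.one_mul
    mul_one := PolymerActivity.mul_one
    left_distrib := PolymerActivity.mul_add
    right_distrib := PolymerActivity.add_mul
    mul_comm := PolymerActivity.mul_comm
    zero_mul := PolymerActivity.zero_mul
    mul_zero := PolymerActivity.mul_zero }

/-- Scalars act compatibly with the circle product: `(c • K) ∘ L = c • (K ∘ L)`. [folklore] -/
theorem smul_mul (c : R) (K L : PolymerActivity Λ R) : (c • K) * L = c • (K * L) := by
  ext X
  simp only [mul_apply, smul_apply, smul_eq_mul, mul_sum, mul_assoc]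

/-- `K ∘ (c • L) = c • (K ∘ L)`. [folklore] -/
theorem mul_smul (c : R) (K L : PolymerActivity Λ R) : K * (c • L) = c • (K * L) := by
  rw [mul_comm, smul_mul, mul_comm]

/-- `PolymerActivity Λ R` is an `R`-algebra. [folklore] -/
instance instAlgebra : Algebra R (PolymerActivity Λ R) :=
  Algebra.ofModule smul_mul mul_smul

/-! ### Nilpotency and the polymer exponential -/

/-- **Powers of an activity vanishing on `∅` vanish on small polymers**: if `K(∅) = 0` then
`K^{∘n}(X) = 0` whenever `|X| < n`. [cite: Brydges2009LecturesRG, §3.1] -/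
theorem pow_apply_eq_zero_of_card_lt {K : PolymerActivity Λ R} (hK : K ∅ = 0) :
    ∀ (n : ℕ) (X : Finset Λ), X.card < n → (K ^ n) X = 0
  | 0, X, h => absurd h (Nat.not_lt_zero _)
  | n + 1, X, h => by
      rw [pow_succ', mul_apply]
      refine sum_eq_zero fun Y hY => ?_
      by_cases hYe : Y = ∅
      · rw [hYe, hK, zero_mul]
      · have hYX : Y ⊆ X := mem_powerset.1 hY
        have hcard : (X \ Y).card < n := by
          have h1 : (X \ Y).card = X.card - Y.card := card_sdiff_of_subset hYX
          have h2 : 0 < Y.card := card_pos.2 (nonempty_iff_ne_empty.2 hYe)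
          have h3 : Y.card ≤ X.card := card_le_card hYX
          omega
        rw [pow_apply_eq_zero_of_card_lt hK n (X \ Y) hcard, mul_zero]

/-- On a finite set of blocks, an activity vanishing on `∅` is **nilpotent**: `K^{∘(|Λ|+1)} = 0`.
[cite: Brydges2009LecturesRG, §3.1] -/
theorem pow_card_succ_eq_zero [Fintype Λ] {K : PolymerActivity Λ R} (hK : K ∅ = 0) :
    K ^ (Fintype.card Λ + 1) = 0 := by
  ext X
  exact pow_apply_eq_zero_of_card_lt hK _ X (Nat.lt_succ_of_le (card_le_univ X))

/-- Nilpotency, as `IsNilpotent`. [folklore] -/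
theorem isNilpotent_of_apply_empty [Fintype Λ] {K : PolymerActivity Λ R} (hK : K ∅ = 0) : IsNilpotent K :=
  ⟨_, pow_card_succ_eq_zero hK⟩

/-- **The polymer exponential** `ℰxp K = ∑_{n ≤ |Λ|} K^{∘n}/n!` of an activity vanishing on `∅`
(Mathlib's `IsNilpotent.exp`), and its multiplicativity `ℰxp(K + L) = ℰxp K ∘ ℰxp L`.
[cite: Brydges2009LecturesRG, §3.1] -/
theorem exp_add_of_apply_empty [Fintype Λ] [Module ℚ R] {K L : PolymerActivity Λ R} (hK : K ∅ = 0)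
    (hL : L ∅ = 0) :
    IsNilpotent.exp (K + L) = IsNilpotent.exp K * IsNilpotent.exp L :=
  IsNilpotent.exp_add_of_commute (Commute.all K L) (isNilpotent_of_apply_empty hK) (isNilpotent_of_apply_empty hL)

/-- The polymer exponential as a finite sum: `ℰxp K = ∑_{n ≤ |Λ|} (n!)⁻¹ • K^{∘n}`. [cite: Brydges2009LecturesRG, §3.1] -/
theorem exp_eq_sum_range_card [Fintype Λ] [Module ℚ R] {K : PolymerActivity Λ R} (hK : K ∅ = 0) :
    IsNilpotent.exp K = ∑ n ∈ range (Fintype.card Λ + 1), ((n.factorial : ℚ)⁻¹) • K ^ n :=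
  IsNilpotent.exp_eq_sum (pow_card_succ_eq_zero hK)

/-- The polymer exponential takes the value `1` on the empty polymer. [folklore] -/
theorem exp_apply_empty [Fintype Λ] [Module ℚ R] {K : PolymerActivity Λ R} (hK : K ∅ = 0) :
    IsNilpotent.exp K ∅ = 1 := by
  rw [exp_eq_sum_range_card hK, sum_range_succ']
  have h0 : ∀ n ∈ range (Fintype.card Λ), ((((n + 1).factorial : ℚ)⁻¹) • K ^ (n + 1)) ∅ = 0 := by
    intro n _
    rw [smul_apply, pow_apply_eq_zero_of_card_lt hK (n + 1) ∅ (by simp), smul_zero]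
  have hsum : (∑ n ∈ range (Fintype.card Λ), ((((n + 1).factorial : ℚ)⁻¹) • K ^ (n + 1))) ∅ = 0 := by
    rw [finset_sum_apply]
    exact sum_eq_zero h0
  rw [add_apply, hsum]
  simp

/-! ### Weighted `ℓ¹` norms -/

section Norm

variable {𝕜 : Type*} [NormedCommRing 𝕜]

omit [DecidableEq Λ] [CommRing R] in
/-- The **weighted `ℓ¹` norm** `‖K‖_w = ∑_X w(X) ‖K(X)‖` of a polymer activity (finite `Λ`).
[cite: Brydges2009LecturesRG, §3.2] -/
def wnorm [Fintype Λ] (w : Finset Λ → ℝ) (K : PolymerActivity Λ 𝕜) : ℝ := ∑ X, w X * ‖K X‖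

omit [DecidableEq Λ] [CommRing R] in
/-- Unfolding `wnorm`. [folklore] -/
theorem wnorm_def [Fintype Λ] (w : Finset Λ → ℝ) (K : PolymerActivity Λ 𝕜) :
    wnorm w K = ∑ X, w X * ‖K X‖ := rfl

omit [DecidableEq Λ] [CommRing R] in
/-- The weighted norm is nonnegative for a nonnegative weight. [folklore] -/
theorem wnorm_nonneg [Fintype Λ] {w : Finset Λ → ℝ} (hw : ∀ X, 0 ≤ w X) (K : PolymerActivity Λ 𝕜) :
    0 ≤ wnorm w K :=
  sum_nonneg fun X _ => mul_nonneg (hw X) (norm_nonneg _)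

omit [DecidableEq Λ] [CommRing R] in
/-- A single value is controlled by the norm: `w(X)‖K(X)‖ ≤ ‖K‖_w`. [folklore] -/
theorem weight_mul_norm_apply_le_wnorm [Fintype Λ] {w : Finset Λ → ℝ} (hw : ∀ X, 0 ≤ w X)
    (K : PolymerActivity Λ 𝕜) (X : Finset Λ) : w X * ‖K X‖ ≤ wnorm w K :=
  single_le_sum (f := fun Y => w Y * ‖K Y‖) (fun Y _ => mul_nonneg (hw Y) (norm_nonneg _)) (mem_univ X)

/-- Triangle inequality for the weighted norm. [folklore] -/
theorem wnorm_add_le [Fintype Λ] {w : Finset Λ → ℝ} (hw : ∀ X, 0 ≤ w X) (K L : PolymerActivity Λ 𝕜) :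
    wnorm w (K + L) ≤ wnorm w K + wnorm w L := by
  simp only [wnorm, ← sum_add_distrib, ← mul_add, add_apply]
  exact sum_le_sum fun X _ => mul_le_mul_of_nonneg_left (norm_add_le _ _) (hw X)

/-- Homogeneity: `‖c • K‖_w = ‖c‖ ‖K‖_w`. [folklore] -/
theorem wnorm_smul [Fintype Λ] (w : Finset Λ → ℝ) (c : 𝕜) (K : PolymerActivity Λ 𝕜) [NormOneClass 𝕜]
    [NormMulClass 𝕜] : wnorm w (c • K) = ‖c‖ * wnorm w K := by
  simp only [wnorm, smul_apply, smul_eq_mul, norm_mul, mul_sum]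
  exact sum_congr rfl fun X _ => by ring

/-- **Submultiplicativity of the weighted `ℓ¹` norm under the circle product.** If the weight is
nonnegative and `w(Y ∪ Z) ≤ w(Y) w(Z)` for disjoint `Y, Z` (e.g. `w(X) = Γ^{|X|}`), then
`‖K ∘ L‖_w ≤ ‖K‖_w ‖L‖_w`. [cite: Brydges2009LecturesRG, §3.2] -/
theorem wnorm_mul_le [Fintype Λ] {w : Finset Λ → ℝ} (hw : ∀ X, 0 ≤ w X)
    (hmul : ∀ Y Z : Finset Λ, Disjoint Y Z → w (Y ∪ Z) ≤ w Y * w Z) (K L : PolymerActivity Λ 𝕜) :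
    wnorm w (K * L) ≤ wnorm w K * wnorm w L := by
  classical
  -- `‖(K∘L)(X)‖ w(X) ≤ ∑_{Y ⊆ X} (w Y ‖K Y‖)(w (X∖Y) ‖L (X∖Y)‖)`
  have hX : ∀ X : Finset Λ, w X * ‖(K * L) X‖ ≤
      ∑ Y ∈ X.powerset, (w Y * ‖K Y‖) * (w (X \ Y) * ‖L (X \ Y)‖) := by
    intro X
    rw [mul_apply]
    calc w X * ‖∑ Y ∈ X.powerset, K Y * L (X \ Y)‖
        ≤ w X * ∑ Y ∈ X.powerset, ‖K Y‖ * ‖L (X \ Y)‖ := by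
          refine mul_le_mul_of_nonneg_left ((norm_sum_le _ _).trans (sum_le_sum fun Y _ => norm_mul_le _ _)) (hw X)
      _ = ∑ Y ∈ X.powerset, w X * (‖K Y‖ * ‖L (X \ Y)‖) := by rw [mul_sum]
      _ ≤ ∑ Y ∈ X.powerset, (w Y * ‖K Y‖) * (w (X \ Y) * ‖L (X \ Y)‖) := by
          refine sum_le_sum fun Y hY => ?_
          have hYX : Y ⊆ X := mem_powerset.1 hY
          have hwX : w X ≤ w Y * w (X \ Y) := by
            have h := hmul Y (X \ Y) disjoint_sdiff
            rwa [union_sdiff_of_subset hYX] at h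
          calc w X * (‖K Y‖ * ‖L (X \ Y)‖) ≤ (w Y * w (X \ Y)) * (‖K Y‖ * ‖L (X \ Y)‖) :=
                mul_le_mul_of_nonneg_right hwX (by positivity)
            _ = (w Y * ‖K Y‖) * (w (X \ Y) * ‖L (X \ Y)‖) := by ring
  -- sum over `X` and re-index the disjoint pairs `(Y, X ∖ Y)` into the product of the two sums
  set f : Finset Λ → ℝ := fun Y => w Y * ‖K Y‖ with hf
  set g : Finset Λ → ℝ := fun Z => w Z * ‖L Z‖ with hg
  have hfg : ∀ Y Z, 0 ≤ f Y * g Z := fun Y Z =>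
    mul_nonneg (mul_nonneg (hw Y) (norm_nonneg _)) (mul_nonneg (hw Z) (norm_nonneg _))
  calc wnorm w (K * L) = ∑ X, w X * ‖(K * L) X‖ := rfl
    _ ≤ ∑ X : Finset Λ, ∑ Y ∈ X.powerset, f Y * g (X \ Y) := sum_le_sum fun X _ => hX X
    _ = ∑ p ∈ (Finset.univ : Finset (Finset Λ)).sigma fun X => X.powerset, f p.2 * g (p.1 \ p.2) := by
        rw [sum_sigma]
    _ = ∑ q ∈ ((Finset.univ : Finset (Finset Λ)).sigma fun X => X.powerset).image
          (fun p => (p.2, p.1 \ p.2)), f q.1 * g q.2 := by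
        symm
        refine sum_image ?_
        rintro ⟨X, Y⟩ hp ⟨X', Y'⟩ hp' heq
        simp only [coe_sigma, Set.mem_sigma_iff, coe_univ, Set.mem_univ, coe_powerset, true_and] at hp hp'
        simp only [Prod.mk.injEq] at heq
        obtain ⟨rfl, h2⟩ := heq
        have : X = X' := by rw [← union_sdiff_of_subset hp, ← union_sdiff_of_subset hp', h2]
        subst this
        rfl
    _ ≤ ∑ q ∈ (Finset.univ : Finset (Finset Λ)) ×ˢ (Finset.univ : Finset (Finset Λ)), f q.1 * g q.2 :=
        sum_le_sum_of_subset_of_nonneg (fun q _ => by simp) fun q _ _ => hfg q.1 q.2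
    _ = wnorm w K * wnorm w L := by
        rw [sum_product, wnorm, wnorm, sum_mul_sum]

/-- The geometric weight `w(X) = Γ^{|X|}` is multiplicative on disjoint unions (so `wnorm_mul_le`
applies). [folklore] -/
theorem pow_card_union_eq {Γ : ℝ} (Y Z : Finset Λ) (h : Disjoint Y Z) :
    Γ ^ (Y ∪ Z).card = Γ ^ Y.card * Γ ^ Z.card := by
  rw [card_union_of_disjoint h, pow_add]

/-- **The `Γ`-norm is a Banach-algebra norm**: `‖K ∘ L‖_Γ ≤ ‖K‖_Γ ‖L‖_Γ` for
`‖K‖_Γ = ∑_X Γ^{|X|} ‖K(X)‖`, `Γ ≥ 0`. [cite: Brydges2009LecturesRG, §3.2] -/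
theorem wnorm_pow_card_mul_le [Fintype Λ] {Γ : ℝ} (hΓ : 0 ≤ Γ) (K L : PolymerActivity Λ 𝕜) :
    wnorm (fun X => Γ ^ X.card) (K * L) ≤ wnorm (fun X => Γ ^ X.card) K * wnorm (fun X => Γ ^ X.card) L :=
  wnorm_mul_le (fun X => pow_nonneg hΓ X.card) (fun Y Z h => (pow_card_union_eq Y Z h).le) K L

/-- **The product property in sup-type weights.** If `‖K(Y)‖ ≤ A a^{|Y|}` and `‖L(Z)‖ ≤ B b^{|Z|}`
for all polymers (`A, a ≥ 0`), then `‖(K ∘ L)(X)‖ ≤ A B (a + b)^{|X|}` (binomial theorem over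
`X.powerset`): with `a = b = Γ⁻¹` this is `‖K ∘ L‖_{Γ/2} ≤ ‖K‖_Γ ‖L‖_Γ` for the sup-norms
`‖K‖_Γ = sup_X Γ^{|X|}‖K(X)‖`. [cite: Brydges2009LecturesRG, §3.2] -/
theorem norm_mul_apply_le_of_pow_card [Fintype Λ] {K L : PolymerActivity Λ 𝕜} {A B a b : ℝ}
    (hA : 0 ≤ A) (ha : 0 ≤ a)
    (hK : ∀ Y : Finset Λ, ‖K Y‖ ≤ A * a ^ Y.card) (hL : ∀ Z : Finset Λ, ‖L Z‖ ≤ B * b ^ Z.card)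
    (X : Finset Λ) : ‖(K * L) X‖ ≤ A * B * (a + b) ^ X.card := by
  rw [mul_apply]
  calc ‖∑ Y ∈ X.powerset, K Y * L (X \ Y)‖
      ≤ ∑ Y ∈ X.powerset, ‖K Y‖ * ‖L (X \ Y)‖ :=
        (norm_sum_le _ _).trans (sum_le_sum fun Y _ => norm_mul_le _ _)
    _ ≤ ∑ Y ∈ X.powerset, (A * a ^ Y.card) * (B * b ^ (X \ Y).card) :=
        sum_le_sum fun Y _ => mul_le_mul (hK Y) (hL _) (norm_nonneg _) (by positivity)
    _ = A * B * ∑ Y ∈ X.powerset, a ^ Y.card * b ^ (X.card - Y.card) := by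
        rw [mul_sum]
        refine sum_congr rfl fun Y hY => ?_
        rw [card_sdiff_of_subset (mem_powerset.1 hY)]
        ring
    _ = A * B * (a + b) ^ X.card := by rw [Finset.sum_pow_mul_eq_add_pow]

end Norm

end PolymerActivity

end Literature.MathematicalPhysics.QuantumFieldTheory

end
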